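import Summits.Parity.GeneralizedHardyLittlewood.Theorems.BeyondDiagonalBeatsQuarter.KernelFormXSqBridge
import HarnessLib

/-!
# Route `PrimeLevelFamEdge`, crux K_A `MomentsBeyondDiagonal` (stmt-Parity-20007), line «petersson_layers» v4, stub `stub_diag`:
# **Selberg coordinates of the KMV mollifier with a general profile** —
# `A_n(x^{(c)}) = W(n)·S⁽ᶜ⁾(M/n;n)/logᶜM`, and `x_P = m^{−1/2}·Σ_c p_c x^{(c)}`

Census item R3(i) of the `stub_diag` roadmap (generalising K_B's `KernelFormXSqBridge.selA_xsq` from the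
profile `X²` to `X^c`). For the KMV coefficients with the pure-power profile
`x^{(c)}_m = μ(m)ψ(m)⁻¹(log(M/m)/log M)ᶜ` the Selberg coordinates of the tree's bridge identity
(`KMV2000.SelbergCoord.quadForm_kmvKernel_eq_scForm`) are

* `selA_pow` — **`A_n(x^{(c)}) = W(n)·S⁽ᶜ⁾(M/n;n)/logᶜM`**, `S⁽ᶜ⁾(y;n) = Σ_{k ≤ y,(k,n)=1} τ(k)W(k)logᶜ(y/k)`
  (the sum evaluated in `…DiagCoprime`: `= c(c−1)E_n log^{c−2}y + O(D(n)(1+log y)^{c−3})`);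
* `selA_sum_mul` — the Selberg coordinates are linear in the coefficient vector;
* `mollifierCoeff_eq_sum_pow` — for every real polynomial `P`,
  `KMV2000.mollifierCoeff P M m = m^{−1/2}·Σ_{c ≤ deg P} P_c·x^{(c)}_m`, so for an admissible `P`
  (`P₀ = P₁ = 0`) only the orders `c ≥ 2` of `…DiagRiesz`/`…DiagCoprime`/`KernelFormXSqCore` occur.

Def-free (the coefficients are written out); theorems only. Helper `--supports stmt-Parity-20007`; closes
nothing; K_A, K_B and the Parity summit are NOT proved; nothing about Landau–Siegel zeros.

## References
* E. Kowalski, P. Michel, J. VanderKam, J. reine angew. Math. 526 (2000), (9) p. 7 and (21)–(23) pp. 12–13.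
  [cite: KowalskiMichelVanderKam2000, (21)–(23) — derivation]
-/

noncomputable section

open scoped Real ArithmeticFunction.Moebius ArithmeticFunction.sigma ArithmeticFunction.zeta
open Finset ArithmeticFunction Polynomial

namespace Summit.Parity.GeneralizedHardyLittlewood.Theorems.MomentsBeyondDiagonal.DiagKernel

open Literature.NumberTheory.LFunctions Literature.NumberTheory.LFunctions.KMV2000
open MollifierMainTerm (W)
open SelbergCoord (selA tauR)
open Summit.Parity.GeneralizedHardyLittlewood.Theorems.BeyondDiagonalBeatsQuarter.KernelFormXSq
  (copTauW copTauW_apply W_apply'' W_eq_zero_of_not_squarefree isMultiplicative_W' sum_Icc_ite_dvd_eq)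

/-- `τ(j)·x^{(c)}_{nj}/(nj) = W(n)·f_n(j)·(log((M/n)/j)/log M)ᶜ` for `n, j ≥ 1` (`f_n = τW·1_{(·,n)=1}`):
`W(nj) = W(n)W(j)` for `(n,j) = 1` and `= 0` otherwise. [cite: KowalskiMichelVanderKam2000, (23) — derivation] -/
theorem tauR_mul_pow_div (M : ℝ) (c : ℕ) {n j : ℕ} (hn : n ≠ 0) (hj : j ≠ 0) :
    tauR (n * j / n) * ((μ (n * j) : ℝ) * ((psi (n * j))⁻¹ *
        (Real.log (M / ((n * j : ℕ) : ℝ)) / Real.log M) ^ c) / ((n * j : ℕ) : ℝ)) =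
      W n * (copTauW n j * (Real.log (M / n / j) / Real.log M) ^ c) := by
  rw [Nat.mul_div_cancel_left j (Nat.pos_of_ne_zero hn), copTauW_apply]
  have hW : (μ (n * j) : ℝ) * ((psi (n * j))⁻¹ * (Real.log (M / ((n * j : ℕ) : ℝ)) / Real.log M) ^ c) /
      ((n * j : ℕ) : ℝ) = W (n * j) * (Real.log (M / ((n * j : ℕ) : ℝ)) / Real.log M) ^ c := by
    rw [W_apply'' (mul_ne_zero hn hj)]
    have : ((n * j : ℕ) : ℝ) ≠ 0 := by exact_mod_cast mul_ne_zero hn hj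
    field_simp
  rw [hW]
  have hlog : Real.log (M / ((n * j : ℕ) : ℝ)) = Real.log (M / n / j) := by
    push_cast; rw [div_div]
  rw [hlog]
  by_cases hc : j.Coprime n
  · rw [if_pos hc, isMultiplicative_W'.map_mul_of_coprime hc.symm, tauR]
    ring
  · rw [if_neg hc]
    have hns : ¬ Squarefree (n * j) := fun h ↦ hc (Nat.coprime_of_squarefree_mul h).symm
    rw [W_eq_zero_of_not_squarefree hns]
    ring

/-- **`A_n(x^{(c)}) = W(n)·S⁽ᶜ⁾(M/n;n)/logᶜM`** for the pure-power profile `x^{(c)}_m = μ(m)ψ(m)⁻¹(log(M/m)/log M)ᶜ`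
(`n ≥ 1`). [cite: KowalskiMichelVanderKam2000, (23) — derivation (Selberg coordinates of the X^c mollifier)] -/
theorem selA_pow (M : ℝ) (c : ℕ) {n : ℕ} (hn : n ≠ 0) :
    selA ⌊M⌋₊ (fun m ↦ (μ m : ℝ) * ((psi m)⁻¹ * (Real.log (M / m) / Real.log M) ^ c)) n =
      W n * (∑ k ∈ Icc 1 ⌊M / n⌋₊, copTauW n k * Real.log (M / n / k) ^ c) / Real.log M ^ c := by
  unfold selA
  rw [sum_Icc_ite_dvd_eq hn, ← Nat.floor_div_natCast, Finset.mul_sum, Finset.sum_div]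
  refine Finset.sum_congr rfl fun j hj ↦ ?_
  have hj0 : j ≠ 0 := by have := (Finset.mem_Icc.1 hj).1; omega
  rw [tauR_mul_pow_div M c hn hj0, div_pow]
  ring

/-- The Selberg coordinates are linear: `A_n(Σ_c a_c x^{(c)}) = Σ_c a_c A_n(x^{(c)})`. [folklore] -/
theorem selA_sum_mul {ι : Type*} (s : Finset ι) (a : ι → ℝ) (x : ι → ℕ → ℝ) (N n : ℕ) :
    selA N (fun m ↦ ∑ i ∈ s, a i * x i m) n = ∑ i ∈ s, a i * selA N (x i) n := by
  unfold selA
  simp_rw [Finset.mul_sum, Finset.sum_div, Finset.mul_sum]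
  rw [Finset.sum_comm]
  refine Finset.sum_congr rfl fun m _ ↦ ?_
  split_ifs with h
  · exact Finset.sum_congr rfl fun i _ ↦ by ring
  · simp

/-- **The KMV coefficient is `m^{−1/2}` times a combination of pure-power profiles**:
`mollifierCoeff P M m = m^{−1/2}·Σ_{c ≤ deg P} P_c·μ(m)ψ(m)⁻¹(log(M/m)/log M)ᶜ`.
[cite: KowalskiMichelVanderKam2000, (9) p. 7 — derivation] -/
theorem mollifierCoeff_eq_sum_pow (P : ℝ[X]) (M : ℝ) (m : ℕ) :
    KMV2000.mollifierCoeff P M m = (m : ℝ) ^ (-(1 / 2 : ℝ)) *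
      ∑ c ∈ Finset.range (P.natDegree + 1),
        P.coeff c * ((μ m : ℝ) * ((psi m)⁻¹ * (Real.log (M / m) / Real.log M) ^ c)) := by
  unfold KMV2000.mollifierCoeff
  rw [Polynomial.eval_eq_sum_range, Finset.mul_sum, Finset.mul_sum, Finset.mul_sum]
  refine Finset.sum_congr rfl fun c _ ↦ ?_
  ring

/-- For an ADMISSIBLE profile (`P(0) = P′(0) = 0`) the orders `c = 0, 1` are absent:
`mollifierCoeff P M m = m^{−1/2}·Σ_{2 ≤ c ≤ deg P} P_c·x^{(c)}_m`. [cite: KowalskiMichelVanderKam2000, (9) p. 7 — derivation] -/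
theorem mollifierCoeff_eq_sum_pow_of_admissible {P : ℝ[X]} (hP : KMV2000.Admissible P) (M : ℝ) (m : ℕ) :
    KMV2000.mollifierCoeff P M m = (m : ℝ) ^ (-(1 / 2 : ℝ)) *
      ∑ c ∈ (Finset.range (P.natDegree + 1)).filter (fun c ↦ 2 ≤ c),
        P.coeff c * ((μ m : ℝ) * ((psi m)⁻¹ * (Real.log (M / m) / Real.log M) ^ c)) := by
  rw [mollifierCoeff_eq_sum_pow, Finset.sum_filter]
  congr 1
  refine Finset.sum_congr rfl fun c _ ↦ ?_
  split_ifs with h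
  · rfl
  · have hc : c = 0 ∨ c = 1 := by omega
    have h0 : P.coeff 0 = 0 := by
      rw [Polynomial.coeff_zero_eq_eval_zero]; exact hP.1
    have h1 : P.coeff 1 = 0 := by
      have := hP.2
      rw [← Polynomial.coeff_zero_eq_eval_zero, Polynomial.coeff_derivative] at this
      simpa using this
    rcases hc with rfl | rfl
    · rw [h0]; ring
    · rw [h1]; ring

end Summit.Parity.GeneralizedHardyLittlewood.Theorems.MomentsBeyondDiagonal.DiagKernel

end
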